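import Mathlib
import Literature.NumberTheory.Automorphic.HilbertModularFormQExpansion
import Summits.Langlands.Langlands.Theorems.CapacityClassicalityHilbertIntegralOverconvergentIsCongruenceBracketBump
import Summits.Langlands.Langlands.Theorems.CapacityClassicalityHilbertIntegralOverconvergentIsCongruenceThetaSeedOne
import Summits.Langlands.Langlands.Theorems.CapacityClassicalityHilbertIntegralOverconvergentIsCongruenceStubSeedPow
import Summits.Langlands.Langlands.Theorems.CapacityClassicalityHilbertIntegralOverconvergentIsCongruenceStubHolNoZeroDivisors
import Summits.Langlands.Langlands.Theorems.CapacityClassicalityHilbertIntegralOverconvergentIsCongruenceStubIndicatorModularForm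

/-!
# The non-parallel supply `Seed.ItemSeedSupply` (line Sketch-ideate-r1-k1, § X, stub X7 — the lead's composition)

RESHAPE 20 (§ X) of line Sketch-ideate-r1-k1 of the crux `HilbertIntegralOverconvergentIsCongruence` (stmt-Langlands-8485):
`itemSeedSupply` — over every totally real `F` of degree `≥ 2`, for every coefficient field `E` receiving all embeddings of `F`
through `τ` and every PARITIOUS weight `k`, there are seed data (`Seed.SeedData`, unfolded): a level `𝔫₀ ≠ 0`, the seed
`S = s^{w₀}` of parallel weight `w₀` (`s` the weight-one theta seed of § W, powers by the landed `stub_seed_pow`) and the shift form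
`G = 1_ℍ · ∏_σ B_σ^{m_σ}` of weight `w₀·𝟙 - k` (`B_σ` the bump forms of `…BracketBump`, `2m_σ = K - k_σ`, `w₀ = 2∑m_σ + K`), `G ≢ 0`,
with `E`-rational `𝓞_E`-integral tube-summable coefficients (`E`-data are multiplicative: `tx_Edata_mul` from the product formula and
stub X6; products of non-zero holomorphic functions on `ℍ` are non-zero; `1_ℍ` has the data).  With § U (`supplyFromSeed`) and the
end-to-end assembly of § T this discharges the supply item (ii) of the typed crux for EVERY paritious weight: the typed crux C′ follows
from the two `q`-expansion-principle items (i′), (i″) alone (`Bracket.TypedCrux_of_two_items` in the line file).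
-/

set_option linter.dupNamespace false

noncomputable section

namespace Summit.Langlands.Langlands.Theorems.HilbertIntegralOverconvergentIsCongruence

open MeasureTheory Complex NumberField
open Literature.NumberTheory.Automorphic Literature.NumberTheory.Automorphic.HilbertModular
open scoped MatrixGroups

/-- **`E`-rational integral tube-summable data are multiplicative** (landed product formula for forms of level `Γ₁(𝔫)`,
integrality of finite sums of products, and the tube-summability of cone convolutions, stub X6). [folklore] -/
theorem tx_Edata_mul (F : Type) [Field F] [NumberField F] [NumberField.IsTotallyReal F]
    (hd : 1 < Module.finrank ℚ F) (𝔫 : Ideal (𝓞 F)) (h𝔫 : 𝔫 ≠ ⊥) (E : Type) [Field E] [NumberField E] (τ : E →+* ℂ)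
    (k l : (F →+* ℝ) → ℤ) (f g : Point F → ℂ) (hf : f ∈ modularForms (Bianchi.Gamma1 𝔫) k)
    (hg : g ∈ modularForms (Bianchi.Gamma1 𝔫) l)
    (qf : F → E) (hqf : ∀ ν ∈ qIndexSet F, fourierCoeff f ν = τ (qf ν)) (hqfi : ∀ ν, IsIntegral ℤ (qf ν))
    (hqfs : ∀ (τ' : E →+* ℂ) (y : (F →+* ℝ) → ℝ), (∀ σ, 0 < y σ) →
      Summable (fun ν : {ν : F | ∀ b : 𝓞 F, ∃ n : ℤ, Algebra.trace ℚ F (ν * b) = n} ↦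
        ‖τ' (qf ν)‖ * Real.exp (-(2 * Real.pi * ∑ σ : F →+* ℝ, σ (ν : F) * y σ))))
    (qg : F → E) (hqg : ∀ ν ∈ qIndexSet F, fourierCoeff g ν = τ (qg ν)) (hqgi : ∀ ν, IsIntegral ℤ (qg ν))
    (hqgs : ∀ (τ' : E →+* ℂ) (y : (F →+* ℝ) → ℝ), (∀ σ, 0 < y σ) →
      Summable (fun ν : {ν : F | ∀ b : 𝓞 F, ∃ n : ℤ, Algebra.trace ℚ F (ν * b) = n} ↦
        ‖τ' (qg ν)‖ * Real.exp (-(2 * Real.pi * ∑ σ : F →+* ℝ, σ (ν : F) * y σ)))) :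
    ∃ q : F → E, (∀ ν ∈ qIndexSet F, fourierCoeff (f * g) ν = τ (q ν)) ∧ (∀ ν, IsIntegral ℤ (q ν)) ∧
      ∀ (τ' : E →+* ℂ) (y : (F →+* ℝ) → ℝ), (∀ σ, 0 < y σ) →
        Summable (fun ν : {ν : F | ∀ b : 𝓞 F, ∃ n : ℤ, Algebra.trace ℚ F (ν * b) = n} ↦
          ‖τ' (q ν)‖ * Real.exp (-(2 * Real.pi * ∑ σ : F →+* ℝ, σ (ν : F) * y σ))) := by
  have hT : ∀ (ν : F) (μ : F × F), μ ∈ (stub_finite_qIndex_antidiagonal F ν).toFinset ↔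
      μ.1 ∈ qIndexSet F ∧ μ.2 ∈ qIndexSet F ∧ μ.1 + μ.2 = ν := fun ν μ ↦ by
    rw [Set.Finite.mem_toFinset]; rfl
  refine ⟨fun ν ↦ ∑ μ ∈ (stub_finite_qIndex_antidiagonal F ν).toFinset, qf μ.1 * qg μ.2, fun ν hν ↦ ?_, fun ν ↦ ?_,
    fun τ' y hy ↦ ?_⟩
  · rw [spw_fourierCoeff_mul_modularForm F hd 𝔫 h𝔫 hf hg hν _ (hT ν), map_sum]
    refine Finset.sum_congr rfl fun μ hμ ↦ ?_
    obtain ⟨h1, h2, -⟩ := (hT ν μ).1 hμ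
    rw [map_mul, hqf μ.1 h1, hqg μ.2 h2]
  · exact IsIntegral.sum _ fun μ _ ↦ (hqfi μ.1).mul (hqgi μ.2)
  · have hmaj := stub_cauchy_product_tube F (fun μ ↦ ‖τ' (qf μ)‖) (fun μ ↦ ‖τ' (qg μ)‖) (fun _ ↦ norm_nonneg _)
      (fun _ ↦ norm_nonneg _) (hqfs τ') (hqgs τ') y hy
    refine hmaj.of_nonneg_of_le (fun ν ↦ mul_nonneg (norm_nonneg _) (Real.exp_pos _).le) (fun ν ↦ ?_)
    refine mul_le_mul_of_nonneg_right ?_ (Real.exp_pos _).le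
    rw [map_sum]
    refine (norm_sum_le _ _).trans (Finset.sum_le_sum fun μ _ ↦ ?_)
    rw [map_mul, norm_mul]

/-- **Products preserve the data of the supply** (modularity with added weights, non-vanishing on `ℍ` — no zero divisors
among holomorphic functions —, and `E`-rational integral tube-summable coefficients, `tx_Edata_mul`). [folklore] -/
theorem tx_mul_step (F : Type) [Field F] [NumberField F] [NumberField.IsTotallyReal F] (hd : 1 < Module.finrank ℚ F)
    (𝔫 : Ideal (𝓞 F)) (h𝔫 : 𝔫 ≠ ⊥) (E : Type) [Field E] [NumberField E] (τ : E →+* ℂ)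
    (kf kg : (F →+* ℝ) → ℤ) (f g : Point F → ℂ)
    (hf : f ∈ modularForms (Bianchi.Gamma1 𝔫) kf ∧ (∃ z ∈ halfSpace F, f z ≠ 0) ∧
      ∃ q : F → E, (∀ ν ∈ qIndexSet F, fourierCoeff f ν = τ (q ν)) ∧ (∀ ν, IsIntegral ℤ (q ν)) ∧
        ∀ (τ' : E →+* ℂ) (y : (F →+* ℝ) → ℝ), (∀ σ, 0 < y σ) →
          Summable (fun ν : {ν : F | ∀ b : 𝓞 F, ∃ n : ℤ, Algebra.trace ℚ F (ν * b) = n} ↦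
            ‖τ' (q ν)‖ * Real.exp (-(2 * Real.pi * ∑ σ : F →+* ℝ, σ (ν : F) * y σ))))
    (hg : g ∈ modularForms (Bianchi.Gamma1 𝔫) kg ∧ (∃ z ∈ halfSpace F, g z ≠ 0) ∧
      ∃ q : F → E, (∀ ν ∈ qIndexSet F, fourierCoeff g ν = τ (q ν)) ∧ (∀ ν, IsIntegral ℤ (q ν)) ∧
        ∀ (τ' : E →+* ℂ) (y : (F →+* ℝ) → ℝ), (∀ σ, 0 < y σ) →
          Summable (fun ν : {ν : F | ∀ b : 𝓞 F, ∃ n : ℤ, Algebra.trace ℚ F (ν * b) = n} ↦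
            ‖τ' (q ν)‖ * Real.exp (-(2 * Real.pi * ∑ σ : F →+* ℝ, σ (ν : F) * y σ)))) :
    f * g ∈ modularForms (Bianchi.Gamma1 𝔫) (kf + kg) ∧ (∃ z ∈ halfSpace F, (f * g) z ≠ 0) ∧
      ∃ q : F → E, (∀ ν ∈ qIndexSet F, fourierCoeff (f * g) ν = τ (q ν)) ∧ (∀ ν, IsIntegral ℤ (q ν)) ∧
        ∀ (τ' : E →+* ℂ) (y : (F →+* ℝ) → ℝ), (∀ σ, 0 < y σ) →
          Summable (fun ν : {ν : F | ∀ b : 𝓞 F, ∃ n : ℤ, Algebra.trace ℚ F (ν * b) = n} ↦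
            ‖τ' (q ν)‖ * Real.exp (-(2 * Real.pi * ∑ σ : F →+* ℝ, σ (ν : F) * y σ))) := by
  obtain ⟨hfm, hfnz, qf, hqf, hqfi, hqfs⟩ := hf
  obtain ⟨hgm, ⟨z₁, hz₁, hgz₁⟩, qg, hqg, hqgi, hqgs⟩ := hg
  refine ⟨mul_mem_modularForms hfm hgm, ?_, tx_Edata_mul F hd 𝔫 h𝔫 E τ kf kg f g hfm hgm qf hqf hqfi hqfs qg hqg hqgi hqgs⟩
  by_contra hall
  push Not at hall
  have hg0 := stub_hol_noZeroDivisors F f g (mem_modularForms_iff.mp hfm).holomorphic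
    (mem_modularForms_iff.mp hgm).holomorphic (fun z hz ↦ by simpa [Pi.mul_apply] using hall z hz) hfnz
  exact hgz₁ (hg0 z₁ hz₁)

/-- The weight-`0` form `1_ℍ` has the data of the supply (coefficients `[ν = 0]`). [folklore] -/
theorem tx_one_data (F : Type) [Field F] [NumberField F] [NumberField.IsTotallyReal F]
    (𝔫 : Ideal (𝓞 F)) (E : Type) [Field E] [NumberField E] (τ : E →+* ℂ) :
    (halfSpace F).indicator (fun _ ↦ (1 : ℂ)) ∈ modularForms (Bianchi.Gamma1 𝔫) 0 ∧
      (∃ z ∈ halfSpace F, (halfSpace F).indicator (fun _ ↦ (1 : ℂ)) z ≠ 0) ∧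
      ∃ q : F → E, (∀ ν ∈ qIndexSet F, fourierCoeff ((halfSpace F).indicator (fun _ ↦ (1 : ℂ))) ν = τ (q ν)) ∧
        (∀ ν, IsIntegral ℤ (q ν)) ∧
        ∀ (τ' : E →+* ℂ) (y : (F →+* ℝ) → ℝ), (∀ σ, 0 < y σ) →
          Summable (fun ν : {ν : F | ∀ b : 𝓞 F, ∃ n : ℤ, Algebra.trace ℚ F (ν * b) = n} ↦
            ‖τ' (q ν)‖ * Real.exp (-(2 * Real.pi * ∑ σ : F →+* ℝ, σ (ν : F) * y σ))) := by
  classical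
  obtain ⟨hmod, h0, hne⟩ := stub_indicator_modularForm F (Bianchi.Gamma1 𝔫)
  refine ⟨hmod, ?_, fun ν ↦ if ν = 0 then 1 else 0, fun ν hν ↦ ?_, fun ν ↦ ?_, fun τ' y _ ↦ ?_⟩
  · refine ⟨fun _ ↦ I, fun σ ↦ by simp, ?_⟩
    rw [Set.indicator_of_mem (show (fun _ ↦ I : Point F) ∈ halfSpace F from fun σ ↦ by simp)]
    exact one_ne_zero
  · dsimp only
    by_cases hν0 : ν = 0
    · subst hν0; simp [h0]
    · rw [if_neg hν0, map_zero]
      exact hne ν hν.1 hν0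
  · dsimp only
    by_cases hν0 : ν = 0
    · rw [if_pos hν0]; exact isIntegral_one
    · rw [if_neg hν0]; exact isIntegral_zero
  · have h0D : (0 : F) ∈ {ν : F | ∀ b : 𝓞 F, ∃ n : ℤ, Algebra.trace ℚ F (ν * b) = n} := fun b ↦ ⟨0, by simp⟩
    refine summable_of_ne_finset_zero (s := {⟨0, h0D⟩}) fun ν hν ↦ ?_
    have hne0 : (ν : F) ≠ 0 := fun h ↦ hν (by rw [Finset.mem_singleton]; exact Subtype.ext h)
    simp [if_neg hne0]


open Classical in
/-- **The NON-PARALLEL SUPPLY (`Seed.ItemSeedSupply`, lead § X).**  Over every totally real `F` of degree `≥ 2`, for every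
coefficient field `E` containing the images of `F` (`τ ∘ ι_σ = σ`) and every PARITIOUS weight `k`, there are seed data: a level
`𝔫₀ ≠ 0`, a seed form `S = s^{w₀}` of parallel weight `w₀` (`s` the weight-one theta seed: `a₀ = 0`, `S ≢ 0`, integer coefficients)
and a SHIFT FORM `G = 1_ℍ · ∏_σ B_σ^{m_σ}` of weight `w₀·𝟙 - k`, `G ≢ 0`, with `E`-rational `𝓞_E`-integral tube-summable
coefficients, where `B_σ` is the Rankin–Cohen bump form of weight `2·𝟙 + 2e_σ` (`tx_bump`), `2 m_σ = K - k_σ` for a large `K ≡ k_σ (2)`,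
and `w₀ = 2 ∑ m_σ + K` (products keep the data, `tx_mul_step`; powers of the seed, landed `stub_seed_pow`). [folklore] -/
theorem itemSeedSupply (F : Type) [Field F] [NumberField F] [NumberField.IsTotallyReal F] (hd : 1 < Module.finrank ℚ F)
    (E : Type) [Field E] [NumberField E] (τ : E →+* ℂ) (hE : ∀ σ : F →+* ℂ, ∃ ι : F →+* E, τ.comp ι = σ)
    (k : (F →+* ℝ) → ℤ) (hpar : ∀ σ σ' : F →+* ℝ, Even (k σ - k σ')) :
    ∃ 𝔫₀ : Ideal (𝓞 F), 𝔫₀ ≠ ⊥ ∧ ∃ (w₀ : (F →+* ℝ) → ℤ) (s G : Point F → ℂ),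
      s ∈ modularForms (Bianchi.Gamma1 𝔫₀) w₀ ∧ fourierCoeff s 0 = 0 ∧ (∃ z ∈ halfSpace F, s z ≠ 0) ∧
      (∃ zc : F → ℤ, ∀ ν ∈ qIndexSet F, fourierCoeff s ν = (zc ν : ℂ)) ∧
      G ∈ modularForms (Bianchi.Gamma1 𝔫₀) (w₀ - k) ∧ (∃ z ∈ halfSpace F, G z ≠ 0) ∧
      ∃ qG : F → E, (∀ ν ∈ qIndexSet F, fourierCoeff G ν = τ (qG ν)) ∧ (∀ ν, IsIntegral ℤ (qG ν)) ∧
        ∀ (τ' : E →+* ℂ) (y : (F →+* ℝ) → ℝ), (∀ σ, 0 < y σ) →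
          Summable (fun ν : {ν : F | ∀ b : 𝓞 F, ∃ n : ℤ, Algebra.trace ℚ F (ν * b) = n} ↦
            ‖τ' (qG ν)‖ * Real.exp (-(2 * Real.pi * ∑ σ : F →+* ℝ, σ (ν : F) * y σ))) := by
  -- (A) the weight-one theta form, its seed, the level
  obtain ⟨𝔫, h𝔫, h, zh, hh, hzh, hh0, hh1⟩ := thetaTwoData F hd
  obtain ⟨hs, hs0, hsnz, zs, hzs⟩ := stub_seed_of_nonconstant F hd 𝔫 h𝔫 (fun _ ↦ (1 : ℤ)) h hh zh hzh
    ⟨1, hcm_one_mem_qIndexSet F, one_ne_zero, hh1⟩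
  set s : Point F → ℂ := fun z ↦ h z - h (fun σ' ↦ ((σ' ((2 : 𝓞 F) : F) : ℝ) : ℂ) * z σ') with hs_def
  set 𝔫₂ : Ideal (𝓞 F) := 𝔫 * Ideal.span {(2 : 𝓞 F)} with h𝔫₂def
  have h𝔫₂ : 𝔫₂ ≠ ⊥ :=
    Ideal.mul_eq_bot.not.mpr (not_or.mpr ⟨h𝔫, Ideal.span_singleton_eq_bot.not.mpr two_ne_zero⟩)
  -- (B) embeddings of `F` into `E` over each real place
  have hι' : ∀ σ : F →+* ℝ, ∃ ι : F →+* E, ∀ x : F, τ (ι x) = ((σ x : ℝ) : ℂ) := by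
    intro σ
    obtain ⟨ι, hι⟩ := hE (Complex.ofRealHom.comp σ)
    exact ⟨ι, fun x ↦ by simpa using congrArg (fun φ : F →+* ℂ ↦ φ x) hι⟩
  choose ι hι using hι'
  -- (C) the bump forms
  choose B hB using fun σ ↦ tx_bump F hd 𝔫 h𝔫 h hh zh hzh hh0 hh1 E τ σ (ι σ) (hι σ)
  set wB : (F →+* ℝ) → (F →+* ℝ) → ℤ := fun σ σ' ↦ (2 : ℤ) + (Pi.single σ (2 : ℤ) : (F →+* ℝ) → ℤ) σ'
    with hwB
  -- (D) the weights: `K ≥ k_σ`, `K ≥ 1`, `K ≡ k_σ (mod 2)`, `2 m_σ = K - k_σ`, `w₀ = 2 ∑ m_σ + K`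
  haveI : Nonempty (F →+* ℝ) := gh_nonempty_realEmbedding F
  obtain ⟨σ₁, -, hσ₁⟩ := Finset.exists_mem_eq_sup' (Finset.univ_nonempty (α := F →+* ℝ)) k
  set kmax : ℤ := Finset.univ.sup' Finset.univ_nonempty k with hkmax
  set K : ℤ := kmax + 2 * ((kmax.natAbs : ℤ) + 1) with hK
  have hKge : ∀ σ, k σ ≤ K := fun σ ↦ by
    have h1 : k σ ≤ kmax := Finset.le_sup' k (Finset.mem_univ σ)
    have h2 : (0 : ℤ) ≤ (kmax.natAbs : ℤ) := Int.natCast_nonneg _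
    rw [hK]
    linarith
  have hK1 : 1 ≤ K := by
    have h1 : -kmax ≤ (kmax.natAbs : ℤ) := by
      rw [Int.natCast_natAbs]
      exact neg_le_abs kmax
    rw [hK]
    linarith
  have hKpar : ∀ σ, ∃ r : ℤ, K - k σ = 2 * r := fun σ ↦ by
    obtain ⟨t, ht⟩ := hpar σ₁ σ
    refine ⟨t + (kmax.natAbs : ℤ) + 1, ?_⟩
    rw [hK, hσ₁]
    linarith
  choose r hr using hKpar
  have hr0 : ∀ σ, 0 ≤ r σ := fun σ ↦ by
    have h1 := hKge σ
    have h2 := hr σ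
    linarith
  set m : (F →+* ℝ) → ℕ := fun σ ↦ (r σ).toNat with hm
  have hm' : ∀ σ, ((m σ : ℕ) : ℤ) = r σ := fun σ ↦ Int.toNat_of_nonneg (hr0 σ)
  set M : ℕ := ∑ σ : F →+* ℝ, m σ with hM
  set w₀ : ℤ := 2 * (M : ℤ) + K with hw₀
  have hw₀1 : 1 ≤ w₀ := by
    have : (0 : ℤ) ≤ (M : ℤ) := Int.natCast_nonneg _
    rw [hw₀]
    linarith
  have hweight : ∑ σ : F →+* ℝ, m σ • wB σ = (fun _ ↦ w₀) - k := by
    funext σ'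
    rw [Finset.sum_apply, Pi.sub_apply]
    have hterm : ∀ σ : F →+* ℝ, (m σ • wB σ) σ' = 2 * (m σ : ℤ) + (if σ' = σ then 2 * (m σ : ℤ) else 0) := by
      intro σ
      rw [Pi.smul_apply, nsmul_eq_mul, hwB]
      dsimp only
      rw [Pi.single_apply]
      split_ifs <;> ring
    rw [Finset.sum_congr rfl fun σ _ ↦ hterm σ, Finset.sum_add_distrib, Finset.sum_ite_eq, if_pos (Finset.mem_univ _),
      ← Finset.mul_sum, hw₀, hM]
    push_cast
    have h1 := hm' σ'
    have h2 := hr σ'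
    linarith
  -- (E) the product form `1_ℍ · ∏_σ B_σ^{m_σ}` has the data, by induction over the places
  have hprod : ∀ S : Finset (F →+* ℝ),
      (halfSpace F).indicator (fun _ ↦ (1 : ℂ)) * ∏ σ' ∈ S, B σ' ^ m σ' ∈ modularForms (Bianchi.Gamma1 𝔫₂) (∑ σ' ∈ S, m σ' • wB σ') ∧ (∃ z ∈ halfSpace F, ((halfSpace F).indicator (fun _ ↦ (1 : ℂ)) * ∏ σ' ∈ S, B σ' ^ m σ') z ≠ 0) ∧
        ∃ q : F → E, (∀ ν ∈ qIndexSet F, fourierCoeff ((halfSpace F).indicator (fun _ ↦ (1 : ℂ)) * ∏ σ' ∈ S, B σ' ^ m σ') ν = τ (q ν)) ∧ (∀ ν, IsIntegral ℤ (q ν)) ∧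
          ∀ (τ' : E →+* ℂ) (y : (F →+* ℝ) → ℝ), (∀ σ, 0 < y σ) →
            Summable (fun ν : {ν : F | ∀ b : 𝓞 F, ∃ n : ℤ, Algebra.trace ℚ F (ν * b) = n} ↦
              ‖τ' (q ν)‖ * Real.exp (-(2 * Real.pi * ∑ σ : F →+* ℝ, σ (ν : F) * y σ))) := by
    intro S
    induction S using Finset.induction_on with
    | empty =>
      rw [Finset.sum_empty, Finset.prod_empty, mul_one]
      exact tx_one_data F 𝔫₂ E τ
    | insert σ S hσS ih =>
      have hpow : ∀ j : ℕ,
          ((halfSpace F).indicator (fun _ ↦ (1 : ℂ)) * ∏ σ' ∈ S, B σ' ^ m σ') * B σ ^ j ∈ modularForms (Bianchi.Gamma1 𝔫₂) ((∑ σ' ∈ S, m σ' • wB σ') + j • wB σ) ∧ (∃ z ∈ halfSpace F, (((halfSpace F).indicator (fun _ ↦ (1 : ℂ)) * ∏ σ' ∈ S, B σ' ^ m σ') * B σ ^ j) z ≠ 0) ∧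
            ∃ q : F → E, (∀ ν ∈ qIndexSet F, fourierCoeff (((halfSpace F).indicator (fun _ ↦ (1 : ℂ)) * ∏ σ' ∈ S, B σ' ^ m σ') * B σ ^ j) ν = τ (q ν)) ∧ (∀ ν, IsIntegral ℤ (q ν)) ∧
              ∀ (τ' : E →+* ℂ) (y : (F →+* ℝ) → ℝ), (∀ σ, 0 < y σ) →
                Summable (fun ν : {ν : F | ∀ b : 𝓞 F, ∃ n : ℤ, Algebra.trace ℚ F (ν * b) = n} ↦
                  ‖τ' (q ν)‖ * Real.exp (-(2 * Real.pi * ∑ σ : F →+* ℝ, σ (ν : F) * y σ))) := by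
        intro j
        induction j with
        | zero =>
          rw [zero_nsmul, add_zero, pow_zero, mul_one]
          exact ih
        | succ j ihj =>
          rw [pow_succ, ← mul_assoc, succ_nsmul, ← add_assoc]
          exact tx_mul_step F hd 𝔫₂ h𝔫₂ E τ _ _ _ _ ihj (hB σ)
      have heq : ((halfSpace F).indicator (fun _ ↦ (1 : ℂ)) * ∏ σ' ∈ insert σ S, B σ' ^ m σ') =
          ((halfSpace F).indicator (fun _ ↦ (1 : ℂ)) * ∏ σ' ∈ S, B σ' ^ m σ') * B σ ^ m σ := by
        rw [Finset.prod_insert hσS]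
        ring
      have hweq : ∑ σ' ∈ insert σ S, m σ' • wB σ' = (∑ σ' ∈ S, m σ' • wB σ') + m σ • wB σ := by
        rw [Finset.sum_insert hσS, add_comm]
      rw [heq, hweq]
      exact hpow (m σ)
  -- (F) the seed of weight `w₀`
  have hw₀nat : 1 ≤ w₀.toNat := (Int.le_toNat (by linarith)).mpr (by exact_mod_cast hw₀1)
  obtain ⟨hSmod, hSnz, hS0, zS, hzS⟩ := stub_seed_pow F hd 𝔫₂ h𝔫₂ (fun _ ↦ (1 : ℤ)) s hs hsnz hs0 zs hzs
    w₀.toNat hw₀nat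
  have hwS : (w₀.toNat • (fun _ : F →+* ℝ ↦ (1 : ℤ))) = fun _ ↦ w₀ := by
    funext σ
    rw [Pi.smul_apply, nsmul_eq_mul, mul_one]
    exact Int.toNat_of_nonneg (by linarith)
  rw [hwS] at hSmod
  -- (G) conclusion
  obtain ⟨hGmod, hGnz, qG, hqG, hqGi, hqGs⟩ := hprod Finset.univ
  rw [hweight] at hGmod
  exact ⟨𝔫₂, h𝔫₂, fun _ ↦ w₀, s ^ w₀.toNat, _, hSmod, hS0, hSnz, ⟨zS, hzS⟩, hGmod, hGnz, qG, hqG, hqGi, hqGs⟩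

end Summit.Langlands.Langlands.Theorems.HilbertIntegralOverconvergentIsCongruence
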